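import Literature.Uncategorized.GammaLowerBound
import Literature.Analysis.Complex.LogDerivHorizontalSegment
import HarnessLib

/-!
# Discharge of `Literature.Uncategorized.HorizontalLogDerivBound` — MOVED (one-line consequences)

The mathematics formerly proved here (the Landau–Titchmarsh bound
`‖f'/f(x + i Im c)‖ ≤ 16 (log(M/‖f(c)‖) + 1)(1/η + 1/R)` for an entire `f` whose zeros in
`‖a - c‖ ≤ R` are `η`-separated in ordinate from `c`, Titchmarsh 1986 §3.9 Lemma α + Jensen) now
lives at its topical home `Literature/Analysis/Complex/LogDerivHorizontalSegment.lean` as the local,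
general-`z` theorem
`Literature.Analysis.Complex.norm_logDeriv_le_of_zeros_im_separated_of_norm_le` and its entire
corollary `Literature.Analysis.Complex.norm_logDeriv_ofReal_add_mul_I_le_of_zeros_im_separated`
(librarian refactor wi-35550, 2026-08-17). This module keeps, with unchanged names and statements,

* `HorizontalLogDerivBound_holds : HorizontalLogDerivBound` — the discharge record of the named fact
  `Literature.Uncategorized.HorizontalLogDerivBound` (still the hypothesis type consumed by
  `Summits/RiemannHypothesis/…/SpectralTraceWindowTracePrime2Stub*.lean` and the registered stub
  `stub_horizontal`), now three lines (`K = 16`);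
* `norm_logDeriv_le_of_zeros_im_separated` — the normalised form `‖g‖ ≤ 1`, deprecated in favour of
  the general theorem (it is its case `M = 1`).

Importers need no change. References: E. C. Titchmarsh, *The Theory of the Riemann Zeta-Function*,
2nd ed. (1986), §3.9 Lemma α. [Titchmarsh1986]
-/

noncomputable section

namespace Literature.Uncategorized

open Complex Set Metric

/-- **Landau–Titchmarsh on a horizontal segment, normalised form** (`‖g‖ ≤ 1` on `‖w - c‖ ≤ 2R`):
`‖g'/g(z)‖ ≤ 16 (log(1/‖g(c)‖) + 1)(1/η + 1/R)` for `Im z = Im c`, `‖z - c‖ ≤ R/4`, when the zeros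
of `g` in `‖a - c‖ ≤ R` are `η`-separated in ordinate. Deprecated: this is the case `M = 1` of
`Literature.Analysis.Complex.norm_logDeriv_le_of_zeros_im_separated_of_norm_le`.
[cite: Titchmarsh1986, §3.9 Lemma α] -/
@[deprecated Literature.Analysis.Complex.norm_logDeriv_le_of_zeros_im_separated_of_norm_le
  (since := "2026-08-17")]
theorem norm_logDeriv_le_of_zeros_im_separated {g : ℂ → ℂ} {c z : ℂ} {R η : ℝ} (hR : 0 < R)
    (hη : 0 < η) (hg : AnalyticOnNhd ℂ g (closedBall c (2 * R))) (hc : g c ≠ 0)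
    (h1 : ∀ w ∈ closedBall c (2 * R), ‖g w‖ ≤ 1)
    (hsep : ∀ a : ℂ, g a = 0 → ‖a - c‖ ≤ R → η ≤ |a.im - c.im|)
    (hz : ‖z - c‖ ≤ R / 4) (hzim : z.im = c.im) :
    ‖logDeriv g z‖ ≤ 16 * (Real.log (1 / ‖g c‖) + 1) * (1 / η + 1 / R) :=
  Literature.Analysis.Complex.norm_logDeriv_le_of_zeros_im_separated_of_norm_le hR hη hg hc h1 hsep
    hz hzim

/-- **DISCHARGE of `Literature.Uncategorized.HorizontalLogDerivBound`** (Landau–Titchmarsh bound for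
`f'/f` on a horizontal segment `η`-separated in ordinate from the zeros of an entire `f`), with the
absolute constant `K = 16`: verbatim
`Literature.Analysis.Complex.norm_logDeriv_ofReal_add_mul_I_le_of_zeros_im_separated`.
[cite: Titchmarsh1986, §3.9 Lemma α] -/
theorem HorizontalLogDerivBound_holds : HorizontalLogDerivBound :=
  ⟨16, by norm_num, fun _f hf _c _R _η _M hR hη hc hM hsep _x hx =>
    Literature.Analysis.Complex.norm_logDeriv_ofReal_add_mul_I_le_of_zeros_im_separated hf hR hη hc
      hM hsep hx⟩

end Literature.Uncategorized

end
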